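import Mathlib
import HarnessLib
import Literature.Analysis.FluidPDE.VectorCalculusProofs
import Literature.Analysis.FluidPDE.AncientSimilarityVorticity
import Summits.NavierStokesRegularity.NavierStokesRegularity.Theorems.UnthreadedDoorAntidynamoWallAntiTwinDrift

/-!
# Route `UnthreadedDoor` / `ThreadingFlux`, crux `PoloidalLiouville` (stmt-NavierStokesRegularity-1222), antidynamo v2 skeleton (4ebf5683127b),
# WALL `stub_scalarLiouville`: GENERALIZED BELTRAMI FLOWS (in any Galilean frame) ARE TRIVIAL IN THE UNTHREADED CLASS

Support file (seat leafhand-ns-unthreadeddoor-2 g1, cell decomp-ns), `--supports stmt-NavierStokesRegularity-1222 --as helper`; theorems only.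

A classical special class of flows: GENERALIZED BELTRAMI flows, whose Lamb vector is a gradient, `curl ((v − b(t)) × ω) = 0` (Beltrami flows
`ω = λ v`, potential flows, and their Galilean translates are instances).  For them the vorticity equation loses its nonlinear terms up to a
spatially constant transport: `curl((v − b) × ω) = Dv[ω] − Dω[v − b]` (`curl_cross_apply`, `div v = div ω = 0`), so `∂ₜω = Δω − Dω[b(t)]` — the
DRIFT–HEAT equation of p816874, whose unthreaded Liouville theorem `curl_eq_zero_of_driftCaloric_unthreaded` (Galilean frame + `heat_liouville` +
tangency) applies verbatim:

* `timeDerivWithin_vorticity_eq_of_lamb_curlFree` — the drift–heat equation of a generalized Beltrami flow in the frame `b(t)`.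
* ★★ `curl_eq_zero_of_lamb_curlFree` — class + unthreaded about `x₀` + `curl ((v(t) − b(t)) × curl v(t)) ≡ 0` for a drift `b` smooth on `(−∞,0)`
  ⇒ `curl v ≡ 0` on `(−∞,0) × ℝ³`; `constant_of_lamb_curlFree`.

HONEST LABEL: a classical sector; nothing here proves `stub_scalarLiouville`, `PoloidalLiouville` (1222), or bears on Navier–Stokes regularity; no
summit statement is proved (crux 1222 is INCOMPARABLE with the summit). [folklore]
[cite: MajdaBertozziCUP2002, §1.1 (vector identities); KochNadirashviliSereginSverak2009, Thm 5.2 (arXiv:0709.3599 pp. 9–10)]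
-/

noncomputable section

-- the summit and its single sub-problem share the name (CONVENTIONS §1)
set_option linter.dupNamespace false

open scoped Topology InnerProductSpace RealInnerProductSpace ContDiff Laplacian
open Filter Set Function Metric MeasureTheory
open Literature.Analysis.FluidPDE

namespace Summit.NavierStokesRegularity.NavierStokesRegularity.Theorems.PoloidalLiouville.Antidynamo

open Summit.NavierStokesRegularity.NavierStokesRegularity.Theorems.PoloidalLiouville
  (constantOfIrrotational vorticityOfClass)

/-- **THE VORTICITY OF A GENERALIZED BELTRAMI FLOW IS DRIFT-CALORIC.**  For a classical solution of the vorticity formulation on `(−∞,0)` whose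
Lamb vector in the frame `b(t)` is curl-free, `curl ((v(t) − b(t)) × curl v(t)) ≡ 0`, the vorticity solves `∂ₜω = Δω − ½ Dω[2 b(t)]`.
[cite: MajdaBertozziCUP2002, §1.1 (vector identities)] -/
theorem timeDerivWithin_vorticity_eq_of_lamb_curlFree
    {v : ℝ → EuclideanSpace ℝ (Fin 3) → EuclideanSpace ℝ (Fin 3)} (hV : IsVorticitySolutionOn (Iio 0) 1 v)
    (b : ℝ → EuclideanSpace ℝ (Fin 3))
    (hlamb : ∀ t < 0, ∀ x, curl (fun y => cross (v t y - b t) (curl (v t) y)) x = 0) {t : ℝ} (ht : t < 0)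
    (x : EuclideanSpace ℝ (Fin 3)) :
    timeDerivWithin (Iio 0) (vorticity v) t x =
      (Δ (vorticity v t)) x - (1 / 2 : ℝ) • fderiv ℝ (vorticity v t) x (((2 : ℝ) • b) t) := by
  have E := hV.vorticity_eq t ht x
  have hvs : ContDiff ℝ ∞ (v t) := hV.contDiff_velocity ht
  have hv2 : ContDiff ℝ 2 (v t) := hvs.of_le (by norm_cast)
  have hω1 : ContDiff ℝ 1 (curl (v t)) := contDiff_curl (n := 1) hv2
  have hvd : DifferentiableAt ℝ (v t) x := (hv2.differentiable (by norm_num)) x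
  have hwd : DifferentiableAt ℝ (fun y => v t y - b t) x := hvd.sub_const _
  have hωd : DifferentiableAt ℝ (curl (v t)) x := (hω1.differentiable one_ne_zero) x
  -- the Lamb identity: `0 = curl((v − b) × ω) = Dv[ω] − Dω[v − b]`
  have hdivv : VectorCalculus.divergence (fun y => v t y - b t) x = 0 := by
    have h1 : VectorCalculus.divergence (v t) x = 0 := hV.divFree t ht x
    simp only [VectorCalculus.divergence] at h1 ⊢
    rw [fderiv_sub_const]
    exact h1
  have hdivω : VectorCalculus.divergence (curl (v t)) x = 0 := divergence_curl_eq_zero_holds (v t) hv2 x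
  have hL := hlamb t ht x
  rw [curl_cross_apply hwd hωd, hdivv, hdivω, zero_smul, zero_smul, sub_zero, add_zero, fderiv_sub_const, map_sub] at hL
  -- `hL : Dv[ω] − (Dω[v] − Dω[b]) = 0`
  rw [one_smul] at E
  have hωfun : vorticity v t = curl (v t) := funext fun y => by rw [vorticity_apply]
  simp only [convect, hωfun] at E
  -- E : T + Dω[v x] = Dv[ω x] + L
  have e2 : ((2 : ℝ) • b) t = (2 : ℝ) • b t := rfl
  rw [hωfun, e2, map_smul, smul_smul, show (1 / 2 : ℝ) * 2 = 1 by norm_num, one_smul]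
  have h2 : fderiv ℝ (v t) x (curl (v t) x) = fderiv ℝ (curl (v t)) x (v t x) - fderiv ℝ (curl (v t)) x (b t) :=
    sub_eq_zero.1 hL
  have h3 : timeDerivWithin (Iio 0) (vorticity v) t x =
      fderiv ℝ (v t) x (curl (v t) x) + (Δ (curl (v t))) x - fderiv ℝ (curl (v t)) x (v t x) := by
    rw [← E]; abel
  rw [h3, h2]
  abel

/-- ★★ **GENERALIZED BELTRAMI FLOWS (IN ANY GALILEAN FRAME) ARE TRIVIAL IN THE UNTHREADED CLASS.**  Let `v` be a bounded ancient mild solution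
(`ν = 1`, duality class) with measurable slices, jointly smooth on `(−∞,0) × ℝ³` and unthreaded about `x₀`.  If for a drift `b` smooth on `(−∞,0)`
the Lamb vector of `v − b` is curl-free at every time, `curl ((v(t) − b(t)) × curl v(t)) ≡ 0`, then `curl v ≡ 0` on `(−∞,0) × ℝ³`.
[cite: KochNadirashviliSereginSverak2009, Thm 5.2 (arXiv:0709.3599 pp. 9–10)] -/
theorem curl_eq_zero_of_lamb_curlFree
    (v : ℝ → EuclideanSpace ℝ (Fin 3) → EuclideanSpace ℝ (Fin 3)) (x₀ : EuclideanSpace ℝ (Fin 3))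
    (hB : Literature.Analysis.FluidPDE.IsBoundedAncientMildSolution 1 v)
    (hm : ∀ t < 0, AEStronglyMeasurable (v t) volume)
    (hsm : ContDiffOn ℝ (⊤ : ℕ∞) (Function.uncurry v) (Set.Iio 0 ×ˢ Set.univ))
    (hun : ∀ t < 0, ∀ x, ⟪x - x₀, curl (v t) x⟫ = 0)
    (b : ℝ → EuclideanSpace ℝ (Fin 3)) (hb : ContDiffOn ℝ ∞ b (Iio 0))
    (hlamb : ∀ t < 0, ∀ x, curl (fun y => cross (v t y - b t) (curl (v t) y)) x = 0) :
    ∀ t < 0, ∀ x, curl (v t) x = 0 := by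
  obtain ⟨hV, K, hK⟩ := vorticityOfClass v hB hm hsm
  have hb2 : ContDiffOn ℝ ∞ ((2 : ℝ) • b) (Iio 0) := hb.const_smul (2 : ℝ)
  exact curl_eq_zero_of_driftCaloric_unthreaded hV hK x₀ hun ((2 : ℝ) • b) hb2 fun t ht x =>
    timeDerivWithin_vorticity_eq_of_lamb_curlFree hV b hlamb ht x

/-- ★★ **… HENCE SLICE-WISE CONSTANT.** [cite: KochNadirashviliSereginSverak2009, Thm 5.2 (arXiv:0709.3599 pp. 9–10)] -/
theorem constant_of_lamb_curlFree
    (v : ℝ → EuclideanSpace ℝ (Fin 3) → EuclideanSpace ℝ (Fin 3)) (x₀ : EuclideanSpace ℝ (Fin 3))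
    (hB : Literature.Analysis.FluidPDE.IsBoundedAncientMildSolution 1 v)
    (hm : ∀ t < 0, AEStronglyMeasurable (v t) volume)
    (hsm : ContDiffOn ℝ (⊤ : ℕ∞) (Function.uncurry v) (Set.Iio 0 ×ˢ Set.univ))
    (hun : ∀ t < 0, ∀ x, ⟪x - x₀, curl (v t) x⟫ = 0)
    (b : ℝ → EuclideanSpace ℝ (Fin 3)) (hb : ContDiffOn ℝ ∞ b (Iio 0))
    (hlamb : ∀ t < 0, ∀ x, curl (fun y => cross (v t y - b t) (curl (v t) y)) x = 0) :
    ∀ t < 0, ∃ c : EuclideanSpace ℝ (Fin 3), ∀ x, v t x = c :=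
  constantOfIrrotational v hB hsm (curl_eq_zero_of_lamb_curlFree v x₀ hB hm hsm hun b hb hlamb)

end Summit.NavierStokesRegularity.NavierStokesRegularity.Theorems.PoloidalLiouville.Antidynamo

end
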